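import Summits.QuantumFields.YangMills.Theorems.UnitScaleGibbsWordTwoElitzurMass
import HarnessLib

/-!
# The mean of the Hessian observable of `SU(2)` lattice Yang–Mills, CLOSED FORM: «mean plaquette × an explicit quadratic form in the letters» —
# the corner terms `{0,3}` closed by the Pauli twirl, and `E[tr(A·U(∂p))] = tr A · E[tr U(∂p)]∕2` for every constant `A`

Cell `ym3-torus` (rung R3 = continuum SU(2) Yang–Mills on T³ — NOT d = 4, NOT infinite volume, NOT a mass gap, NOT Clay); width seat `ym3-torus-px17` gen 7;
`--supports stmt-QuantumFields-23083 --as helper`; sequel of ✓ `UnitScaleGibbsWordTwoElitzurMass` (Elitzur chain (E2) ✓p742394 → (E1) ✓p742765 → (E2-SU2)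
✓p743029 → (E2-MASS) ✓p744099).  For w8-19936 g10's FINDING §2 («`E Hess_out ≍ 4‖v‖²`», the raw-region 1-form mass): the two CORNER double insertions `(0,3)`,
`(3,0)` of a plaquette (both letters at `p.src`) are the SAME matrix, of trace `−tr(u_{e₃}u_{e₀}·ρ U(∂p))`, and by the site twirl at `p.src` the mean of `tr(A·ρU(∂p))`
is `tr A · E[tr ρU(∂p)]∕2` for every CONSTANT `A ∈ M₂(ℂ)` — so the raw-region mean of `∂_u∂_u A` is, plaquette by plaquette,
  `E[∂_u∂_u A_W] = Σ_p Re((Σ_i det u_{b_i(p)} + tr(u_{e₃(p)}u_{e₀(p)})) · E[tr U(∂p)]) ∕ 2`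
— the MEAN PLAQUETTE times an explicit, `U`-free quadratic form of the letters (for 𝔰𝔲(2) letters: `det u = ½‖u‖²_F`, `tr(u₃u₀) = −⟨u₃,u₀⟩_F`).

WHAT IS PROVED (ns `…Theorems.UnitScaleGibbsWordTwoElitzurCorner`; THEOREMS ONLY, 0 `def`, 0 `sorry`): §1 `word_slot_gaugeAct`, `rho_plaqHol_gaugeAct` (matrix model);
`word₂_corner_eq` (`word₂ p 3 0 = word₂ p 0 3`), `trace_word₂_corner`; §2 `integral_comp_gaugeAct_gibbsMeasure` (Banach-valued change of variables under
`gibbsMeasure`, any `[GaugeGroup G]`), ★★ `su2_integral_trace_const_mul_plaqHol` (`∫ tr(A·W_p) = tr A·∫ tr W_p ∕ 2`); §3 ★★★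
`su2_integral_actionDeriv₂_eq_form_mul_meanPlaquette`.

HONEST SCOPE.  Exact finite-`β` identities; nothing of `stub_linTest` (nor its redesign), 23083, K1, `HistoryTailL` or any rung is proved; the Yang–Mills mass gap is
NOT proved.
References: S. Elitzur, Phys. Rev. D 12 (1975) 3978 [Elitzur1975]; M. Creutz, Quarks, gluons and lattices, Ch. 9, 11 [Creutz2022]; L. Gross, CMP 92 (1983) Thm 2.2 [GrossCMP1983].
-/

set_option autoImplicit false

noncomputable section
open MeasureTheory
open scoped BigOperators
open Literature.MathematicalPhysics.QuantumFieldTheory.Balaban1983to89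
open Literature.MathematicalPhysics.QuantumFieldTheory.Balaban1983to89.T4GenFunBounds (gibbsMeasure isProbabilityMeasure_gibbsMeasure)
open Literature.MathematicalPhysics.QuantumFieldTheory.Balaban1983to89.T3UnitLawGaugeInvariance (gaugeAct_gaugeAct map_gaugeAct_gibbsMeasure)
open Literature.MathematicalPhysics.QuantumFieldTheory.Balaban1983to89.T4AxialGaugeFixing (siteTransf siteTransf_self gaugeAct_const_one)
open Literature.MathematicalPhysics.QuantumLattice (fundamentalRep continuous_fundamentalRep)
open Summit.QuantumFields.YangMills.Theorems.UnitScaleGibbsActionDerivativeSlotCalculus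
open Summit.QuantumFields.YangMills.Theorems.UnitScaleGibbsWordTwoElitzur (slot_gaugeAct word_telescope)
open Summit.QuantumFields.YangMills.Theorems.UnitScaleGibbsElitzurOrthogonality (pauli_twirl quatI_mem quatK_mem star_quat_eq)
open Summit.QuantumFields.YangMills.Theorems.UnitScaleGibbsWordTwoElitzurSU2
open Summit.QuantumFields.YangMills.Theorems.UnitScaleGibbsWordTwoElitzurMass

namespace Summit.QuantumFields.YangMills.Theorems.UnitScaleGibbsWordTwoElitzurCorner

/-! ## §1 The plaquette word under a gauge transformation; the two corner words coincide -/

section Words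

variable {N : ℕ} {P : Params} {j : ℕ} {G : Type} [GaugeGroup G]
  (ρ : G →* Matrix (Fin N) (Fin N) ℂ) (u : PBond P j → Matrix (Fin N) (Fin N) ℂ)

/-- `word(slot(U^v)) = ρ(v x)·word(slot U)·ρ((v x)⁻¹)` (no insertion). [cite: Creutz2022, Ch. 9] -/
theorem word_slot_gaugeAct (v : GaugeTransf P j G) (U : GaugeField P j G) (p : Plaq P j) :
    word (slot ρ (GaugeField.gaugeAct v U) p) = ρ (v p.src) * word (slot ρ U p) * ρ ((v p.src)⁻¹) := by
  rw [slot_gaugeAct ρ v U p, word_telescope]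
  · rfl
  · show ρ ((v (p.src.shift p.μ))⁻¹) * ρ (v (p.src.shift p.μ)) = 1
    rw [← map_mul, inv_mul_cancel, map_one]
  · show ρ ((v ((p.src.shift p.μ).shift p.ν))⁻¹) * ρ (v ((p.src.shift p.μ).shift p.ν)) = 1
    rw [← map_mul, inv_mul_cancel, map_one]
  · show ρ ((v (p.src.shift p.ν))⁻¹) * ρ (v (p.src.shift p.ν)) = 1
    rw [← map_mul, inv_mul_cancel, map_one]

/-- `ρ(U^v(∂p)) = ρ(v x)·ρ(U(∂p))·ρ((v x)⁻¹)` in the matrix model. [cite: Balaban1985Averaging, (9) p.19] -/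
theorem rho_plaqHol_gaugeAct (v : GaugeTransf P j G) (U : GaugeField P j G) (p : Plaq P j) :
    ρ (GaugeField.plaqHol (GaugeField.gaugeAct v U) p) = ρ (v p.src) * ρ (GaugeField.plaqHol U p) * ρ ((v p.src)⁻¹) := by
  rw [rho_plaqHol_eq_word, rho_plaqHol_eq_word, word_slot_gaugeAct]

/-- The two CORNER double-insertion words coincide: `word₂ p 3 0 = word₂ p 0 3` (two first insertions at different slots commute as updates). [folklore] -/
theorem word₂_corner_eq (U : GaugeField P j G) (p : Plaq P j) : word₂ ρ u U p 3 0 = word₂ ρ u U p 0 3 := by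
  unfold word₂
  rw [if_neg (by decide : (0 : Fin 4) ≠ 3), if_neg (by decide : (3 : Fin 4) ≠ 0), Function.update_comm (by decide : (3 : Fin 4) ≠ 0)]

/-- The corner word's trace: `tr word₂(p;0,3) = −tr(u_{e₃}·u_{e₀}·ρU(∂p))` (both letters sit at `p.src`; cyclicity of the trace). [cite: Creutz2022, Ch. 11] -/
theorem trace_word₂_corner (U : GaugeField P j G) (p : Plaq P j) :
    (word₂ ρ u U p 0 3).trace = -(u (slotBond p 3) * u (slotBond p 0) * ρ (GaugeField.plaqHol U p)).trace := by
  have h3 : slotBond p 3 = ⟨p.src, p.ν⟩ := rfl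
  have h0 : slotBond p 0 = ⟨p.src, p.μ⟩ := rfl
  rw [h3, h0, rho_plaqHol_eq_word]
  simp only [word₂, word, slot, slotIns, if_neg (by decide : (3 : Fin 4) ≠ 0), Function.update_self,
    Function.update_of_ne (by decide : (0 : Fin 4) ≠ 3), Function.update_of_ne (by decide : (1 : Fin 4) ≠ 3),
    Function.update_of_ne (by decide : (2 : Fin 4) ≠ 3), Function.update_of_ne (by decide : (1 : Fin 4) ≠ 0),
    Function.update_of_ne (by decide : (2 : Fin 4) ≠ 0), Matrix.cons_val_zero, Matrix.cons_val_one, Matrix.head_cons,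
    Matrix.cons_val_two, Matrix.tail_cons, Matrix.cons_val_three, mul_neg, Matrix.trace_neg]
  rw [show u ⟨p.src, p.μ⟩ * ρ (U ⟨p.src, p.μ⟩) * ρ (U ⟨p.src.shift p.μ, p.ν⟩) * ρ ((U ⟨p.src.shift p.ν, p.μ⟩)⁻¹) *
      (ρ ((U ⟨p.src, p.ν⟩)⁻¹) * u ⟨p.src, p.ν⟩) =
      (u ⟨p.src, p.μ⟩ * (ρ (U ⟨p.src, p.μ⟩) * ρ (U ⟨p.src.shift p.μ, p.ν⟩) * ρ ((U ⟨p.src.shift p.ν, p.μ⟩)⁻¹) * ρ ((U ⟨p.src, p.ν⟩)⁻¹))) *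
        u ⟨p.src, p.ν⟩ by noncomm_ring, Matrix.trace_mul_comm, ← mul_assoc]

end Words

/-! ## §2 Change of variables under `gibbsMeasure` for Banach-valued integrands; the twirl of a constant matrix against the plaquette -/

section Twirl

variable {P : Params} {G : Type} [GaugeGroup G] [MeasurableSpace G] [HaarData G] [RegularGaugeGroup G]

/-- **Gauge invariance of `μ_β` as a change of variables for Banach-valued integrands**: `∫ F(U^v) dμ_β = ∫ F dμ_β` (`β ≥ 0`; the gauge action is a
measurable equivalence with inverse the action of `v⁻¹`, and `(·)^v_* μ_β = μ_β`, lit ✓ `map_gaugeAct_gibbsMeasure`). [cite: Balaban1985Averaging, (12) p.19] -/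
theorem integral_comp_gaugeAct_gibbsMeasure {E : Type} [NormedAddCommGroup E] [NormedSpace ℝ E] {β : ℝ} (hβ : 0 ≤ β) (v : GaugeTransf P 0 G)
    (F : GaugeField P 0 G → E) :
    ∫ U, F (GaugeField.gaugeAct v U) ∂gibbsMeasure P β = ∫ U, F U ∂gibbsMeasure P β := by
  let e : GaugeField P 0 G ≃ᵐ GaugeField P 0 G :=
    { toFun := GaugeField.gaugeAct v
      invFun := GaugeField.gaugeAct (fun x => (v x)⁻¹)
      left_inv := fun U => by
        show GaugeField.gaugeAct (fun x => (v x)⁻¹) (GaugeField.gaugeAct v U) = U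
        rw [gaugeAct_gaugeAct]; simp only [inv_mul_cancel]; exact gaugeAct_const_one U
      right_inv := fun U => by
        show GaugeField.gaugeAct v (GaugeField.gaugeAct (fun x => (v x)⁻¹) U) = U
        rw [gaugeAct_gaugeAct]; simp only [mul_inv_cancel]; exact gaugeAct_const_one U
      measurable_toFun := B12RTGaugeInvariance254.measurable_gaugeAct v
      measurable_invFun := B12RTGaugeInvariance254.measurable_gaugeAct (fun x => (v x)⁻¹) }
  have hmp : MeasurePreserving e (gibbsMeasure P β) (gibbsMeasure P β) := ⟨e.measurable, map_gaugeAct_gibbsMeasure P hβ v⟩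
  exact hmp.integral_comp' F

end Twirl

section SU2Twirl

variable {P : Params}

open Complex

/-- `U ↦ tr(A·ρU(∂p))` is integrable for `μ_β` (continuous on the compact carrier). [folklore] -/
theorem integrable_trace_const_mul_plaqHol {β : ℝ} (hβ : 0 ≤ β) (A : Matrix (Fin 2) (Fin 2) ℂ) (p : Plaq P 0) :
    Integrable (fun U : GaugeField P 0 (Matrix.specialUnitaryGroup (Fin 2) ℂ) => (A * fundamentalRep (Fin 2) (GaugeField.plaqHol U p)).trace)
      (gibbsMeasure P β) := by
  haveI : SecondCountableTopology (Matrix.specialUnitaryGroup (Fin 2) ℂ) := by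
    haveI := secondCountableTopology_matrix (n := Fin 2)
    exact Topology.IsEmbedding.subtypeVal.secondCountableTopology
  haveI : CompactSpace (GaugeField P 0 (Matrix.specialUnitaryGroup (Fin 2) ℂ)) :=
    inferInstanceAs (CompactSpace (PBond P 0 → Matrix.specialUnitaryGroup (Fin 2) ℂ))
  haveI : OpensMeasurableSpace (GaugeField P 0 (Matrix.specialUnitaryGroup (Fin 2) ℂ)) :=
    inferInstanceAs (OpensMeasurableSpace (PBond P 0 → Matrix.specialUnitaryGroup (Fin 2) ℂ))
  haveI := isProbabilityMeasure_gibbsMeasure (G := Matrix.specialUnitaryGroup (Fin 2) ℂ) P hβ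
  have hc : Continuous fun U : GaugeField P 0 (Matrix.specialUnitaryGroup (Fin 2) ℂ) => (A * fundamentalRep (Fin 2) (GaugeField.plaqHol U p)).trace := by
    refine (continuous_const.mul ?_).matrix_trace
    rw [show (fun U : GaugeField P 0 (Matrix.specialUnitaryGroup (Fin 2) ℂ) => fundamentalRep (Fin 2) (GaugeField.plaqHol U p)) =
      fun U => word (slot (fundamentalRep (Fin 2)) U p) from funext fun U => rho_plaqHol_eq_word _ U p]
    exact continuous_word_comp (continuous_slot (continuous_fundamentalRep (Fin 2)) p)
  obtain ⟨C, hC⟩ := isCompact_univ.exists_bound_of_continuousOn hc.continuousOn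
  exact Integrable.of_bound hc.measurable.aestronglyMeasurable C (ae_of_all _ fun U => hC U (Set.mem_univ U))

/-- ★★ **THE TWIRL OF A CONSTANT MATRIX AGAINST THE PLAQUETTE**: for every `A ∈ M₂(ℂ)`, every plaquette `p` and `β ≥ 0`,
`∫ tr(A·ρU(∂p)) dμ_β = tr A · ∫ tr ρU(∂p) dμ_β ∕ 2` — the site rotations by `1, 𝐢, 𝐣, 𝐤` at `p.src` conjugate `U(∂p)`, `μ_β` is invariant, and
`Σ_q q⁻¹Aq = 2 tr A·1` (w8's ✓ `pauli_twirl`). [cite: Elitzur1975, §II] -/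
theorem su2_integral_trace_const_mul_plaqHol {β : ℝ} (hβ : 0 ≤ β) (A : Matrix (Fin 2) (Fin 2) ℂ) (p : Plaq P 0) :
    ∫ U, (A * fundamentalRep (Fin 2) (GaugeField.plaqHol U p)).trace ∂gibbsMeasure P β =
      A.trace * (∫ U, (fundamentalRep (Fin 2) (GaugeField.plaqHol U p)).trace ∂gibbsMeasure P β) / 2 := by
  set μ := gibbsMeasure (G := Matrix.specialUnitaryGroup (Fin 2) ℂ) P β with hμ
  let q : Fin 4 → Matrix.specialUnitaryGroup (Fin 2) ℂ :=
    ![1, ⟨!![I, 0; 0, -I], quatI_mem⟩, ⟨!![(0 : ℂ), 1; -1, 0], FiniteSusceptibilityWeakCoupling.SU2ConjugationEven.J_mem⟩, ⟨!![0, I; I, 0], quatK_mem⟩]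
  have hinv : ∀ g : Matrix.specialUnitaryGroup (Fin 2) ℂ,
      ((g⁻¹ : Matrix.specialUnitaryGroup (Fin 2) ℂ).val : Matrix (Fin 2) (Fin 2) ℂ) = star g.val := fun g => rfl
  -- each rotated integrand is the integrand of the conjugated constant
  have hrot : ∀ (k : Fin 4) (U : GaugeField P 0 (Matrix.specialUnitaryGroup (Fin 2) ℂ)),
      (A * fundamentalRep (Fin 2) (GaugeField.plaqHol (GaugeField.gaugeAct (siteTransf p.src (q k)) U) p)).trace =
        (star (q k).val * A * (q k).val * fundamentalRep (Fin 2) (GaugeField.plaqHol U p)).trace := fun k U => by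
    rw [rho_plaqHol_gaugeAct, siteTransf_self, ← hinv]
    rw [show A * (fundamentalRep (Fin 2) (q k) * fundamentalRep (Fin 2) (GaugeField.plaqHol U p) * fundamentalRep (Fin 2) (q k)⁻¹) =
        (A * fundamentalRep (Fin 2) (q k) * fundamentalRep (Fin 2) (GaugeField.plaqHol U p)) * fundamentalRep (Fin 2) (q k)⁻¹ by noncomm_ring,
      Matrix.trace_mul_comm, ← mul_assoc, ← mul_assoc]
    rfl
  -- the four conjugated constants sum to `2 tr A · 1`
  have htw : ∑ k : Fin 4, star (q k).val * A * (q k).val = (2 * A.trace) • (1 : Matrix (Fin 2) (Fin 2) ℂ) := by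
    obtain ⟨hqI, hqJ, hqK⟩ := star_quat_eq
    rw [Fin.sum_univ_four]
    simp only [q, Matrix.cons_val_zero, Matrix.cons_val_one, Matrix.head_cons, Matrix.cons_val_two, Matrix.tail_cons, Matrix.cons_val_three,
      OneMemClass.coe_one, star_one, one_mul, mul_one, hqI, hqJ, hqK]
    have h := pauli_twirl A
    simp only [neg_mul] at h ⊢
    exact h
  -- sum the four copies of the integral
  have hI := integrable_trace_const_mul_plaqHol (P := P) hβ
  have h4 : (4 : ℂ) * ∫ U, (A * fundamentalRep (Fin 2) (GaugeField.plaqHol U p)).trace ∂μ =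
      ∑ k : Fin 4, ∫ U, (star (q k).val * A * (q k).val * fundamentalRep (Fin 2) (GaugeField.plaqHol U p)).trace ∂μ := by
    rw [show (4 : ℂ) * ∫ U, (A * fundamentalRep (Fin 2) (GaugeField.plaqHol U p)).trace ∂μ =
        ∑ k : Fin 4, ∫ U, (A * fundamentalRep (Fin 2) (GaugeField.plaqHol U p)).trace ∂μ by simp]
    refine Finset.sum_congr rfl fun k _ => ?_
    rw [← integral_comp_gaugeAct_gibbsMeasure hβ (siteTransf p.src (q k))]
    exact integral_congr_ae (ae_of_all _ fun U => hrot k U)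
  rw [← integral_finsetSum _ fun k _ => hI _ p] at h4
  simp_rw [← Matrix.trace_sum, ← Finset.sum_mul] at h4
  rw [htw] at h4
  simp_rw [smul_mul_assoc, one_mul, Matrix.trace_smul, smul_eq_mul] at h4
  rw [integral_const_mul] at h4
  have h4' : ∫ U, (A * fundamentalRep (Fin 2) (GaugeField.plaqHol U p)).trace ∂μ =
      (2 * A.trace * ∫ U, (fundamentalRep (Fin 2) (GaugeField.plaqHol U p)).trace ∂μ) / 4 := by
    rw [← h4]; ring
  rw [h4']; ring

end SU2Twirl

/-! ## §3 The mean of `∂_u∂_u A` for `SU(2)`: mean plaquette × quadratic form -/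

section SU2

variable {P : Params}

/-- ★★★ **THE MEAN OF THE HESSIAN OBSERVABLE, CLOSED FORM** (`SU(2)`, `β ≥ 0`, every torus, every traceless letter field `u`):
`∫ ∂_u∂_u A_W dμ_β = Σ_p Re((Σ_i det u_{b_i(p)} + tr(u_{e₃(p)}·u_{e₀(p)})) · ∫ tr U(∂p) dμ_β) ∕ 2` — the MEAN PLAQUETTE times a `U`-free quadratic form of
the letters (`e₀(p) = ⟨x,μ⟩`, `e₃(p) = ⟨x,ν⟩` the two bonds at the corner `x = p.src`).  Mass by Cayley–Hamilton, corners by the twirl of the constant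
`u_{e₃}u_{e₀}`, all other pairs zero by Elitzur. [cite: Elitzur1975, §II] -/
theorem su2_integral_actionDeriv₂_eq_form_mul_meanPlaquette {β : ℝ} (hβ : 0 ≤ β) (u : PBond P 0 → Matrix (Fin 2) (Fin 2) ℂ)
    (hu : ∀ b, (u b).trace = 0) :
    ∫ U, actionDeriv₂ (fundamentalRep (Fin 2)) u U ∂gibbsMeasure P β =
      ∑ p : Plaq P 0, (((∑ i : Fin 4, (u (slotBond p i)).det) + (u (slotBond p 3) * u (slotBond p 0)).trace) *
          ∫ U, (fundamentalRep (Fin 2) (GaugeField.plaqHol U p)).trace ∂gibbsMeasure P β).re / 2 := by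
  rw [su2_integral_actionDeriv₂_eq_mass_add_corner hβ u hu, ← Finset.sum_add_distrib]
  refine Finset.sum_congr rfl fun p _ => ?_
  have hI := integrable_trace_const_mul_plaqHol (P := P) hβ
  -- the diagonal terms: pull the constant and the real part out of the integral
  have hdiag : ∀ i : Fin 4, ∫ U, ((u (slotBond p i)).det * (fundamentalRep (Fin 2) (GaugeField.plaqHol U p)).trace).re / 2 ∂gibbsMeasure P β =
      ((u (slotBond p i)).det * ∫ U, (fundamentalRep (Fin 2) (GaugeField.plaqHol U p)).trace ∂gibbsMeasure P β).re / 2 := fun i => by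
    have h1 : Integrable (fun U : GaugeField P 0 (Matrix.specialUnitaryGroup (Fin 2) ℂ) =>
        (u (slotBond p i)).det * (fundamentalRep (Fin 2) (GaugeField.plaqHol U p)).trace) (gibbsMeasure P β) := by
      have := hI ((u (slotBond p i)).det • (1 : Matrix (Fin 2) (Fin 2) ℂ)) p
      simpa [smul_mul_assoc, Matrix.trace_smul] using this
    have h2 := integral_re h1
    simp only [RCLike.re_to_complex] at h2
    rw [integral_div, h2, integral_const_mul]
  -- the corner terms: equal words, trace `−tr(u₃u₀W)`, twirl of the constant `u₃u₀`
  have hcorner : ∫ U, -((word₂ (fundamentalRep (Fin 2)) u U p 0 3).trace.re / ((2 : ℕ) : ℝ)) ∂gibbsMeasure P β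
      + ∫ U, -((word₂ (fundamentalRep (Fin 2)) u U p 3 0).trace.re / ((2 : ℕ) : ℝ)) ∂gibbsMeasure P β =
      ((u (slotBond p 3) * u (slotBond p 0)).trace * ∫ U, (fundamentalRep (Fin 2) (GaugeField.plaqHol U p)).trace ∂gibbsMeasure P β).re / 2 := by
    have h2 := integral_re (hI (u (slotBond p 3) * u (slotBond p 0)) p)
    simp only [RCLike.re_to_complex] at h2
    have h3 : ∀ U : GaugeField P 0 (Matrix.specialUnitaryGroup (Fin 2) ℂ),
        -((word₂ (fundamentalRep (Fin 2)) u U p 3 0).trace.re / ((2 : ℕ) : ℝ)) =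
          (u (slotBond p 3) * u (slotBond p 0) * fundamentalRep (Fin 2) (GaugeField.plaqHol U p)).trace.re / 2 := fun U => by
      rw [word₂_corner_eq, trace_word₂_corner, Complex.neg_re, neg_div, neg_neg, Nat.cast_ofNat]
    have h3' : ∀ U : GaugeField P 0 (Matrix.specialUnitaryGroup (Fin 2) ℂ),
        -((word₂ (fundamentalRep (Fin 2)) u U p 0 3).trace.re / ((2 : ℕ) : ℝ)) =
          (u (slotBond p 3) * u (slotBond p 0) * fundamentalRep (Fin 2) (GaugeField.plaqHol U p)).trace.re / 2 := fun U => by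
      rw [← word₂_corner_eq]; exact h3 U
    simp only [h3, h3']
    rw [integral_div, h2, su2_integral_trace_const_mul_plaqHol hβ, Complex.div_ofNat_re]
    ring
  rw [hcorner, Finset.sum_congr rfl fun i _ => hdiag i, ← Finset.sum_div, ← add_div, ← Complex.re_sum, ← Finset.sum_mul, ← Complex.add_re,
    ← add_mul]

end SU2

end Summit.QuantumFields.YangMills.Theorems.UnitScaleGibbsWordTwoElitzurCorner
end
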